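import Mathlib
import Literature.MathematicalPhysics.QuantumFieldTheory.Balaban1983to89.B13Ineq140
import Literature.MathematicalPhysics.QuantumFieldTheory.Balaban1983to89.B13

/-!
# `Balaban1983to89.B13Bound143OneShot` — the bookkeeping (1.39)/(1.40) ⇒ (1.43) of B13 Lemma 2 by ONE-SHOT
# absorption, its implicit restriction κ₁ ≥ 11/3, and the consumption (1.43) × |τ(Y)| ⇒ (2.19) under R12

CITATION HEADER (lean-in-tree rule 2026-08-18).  T. Bałaban, *Renormalization group approach to lattice gauge field
theories. II. Cluster expansions*, Commun. Math. Phys. **116**, 1–22 (1988), doi:10.1007/bf01239022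
[Balaban1988RG2Cluster] (cell paper B13; held `paper:balaban1988-cmp116-rg-ii-cluster`, journal page = PDF page).
Every display quoted below was compared with the renders `b2b-balaban-ref1/pages/1988-cmp116-rg-II-cluster/
1988-cmp116-rg-II-cluster-p010-x2.png`, `…-p011-x2.png`, `…-p016-x2.png` READ AS IMAGES (2026-08-19), not from the
OCR layer.  The paper is UNDER ADJUDICATION by the audit cell `pub-balaban`; nothing of it is asserted here: the
printed analytic inputs (the analyticity of (1.38) in B′ and the bound (1.39), whose inputs are (33), (37), (55), (57),
(58) of [15] = B11 by reference — cell GAPS G-B13-01…05) enter as explicit HYPOTHESES exactly as in the sibling module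
`…Balaban1983to89.B13Ineq140` (unit pv20-g2, whose `Ineq139`, `coeff140`, `rad`, `ineq140_sharp`,
`norm_sum_le_exp_card_mul` are used BY NAME), the constants record `B13.Consts` and the verbatim statement of record
`B13.Bound143` of `…Balaban1983to89.B13` (unit r2/b13) are used BY NAME, and what is proved is proved by the kernel
from Mathlib (real arithmetic, `Real.exp`/`Real.log` monotonicity).  This module is a NEW LEAF: it imports `B13Ineq140`
and `B13` and modifies nothing.  Unit `b2b-balaban-b13-g23` (paper sub-cell B13, gen 23); cell records GAPS C-B13-49
(owner-side reading of C-adv7-151/152/153), C-B13-50 (this leaf), DIVERGENCE D-b13.32 (modelling conventions below);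
second engine to the NOT-proposed scratch kernel `b2b-balaban-adv7/g61/Adv7G61.lean` (`absorb143`, `sequential_loss`)
of GAPS C-adv7-152, whose located finding this file makes a tree fact.

WHAT IS PRINTED (verbatim).
* p. 10, (1.39): *"The estimates (33), (37), (55), (57), (58) [15] imply the bound
  |(1.38)| ≦ C₃(e^{16κ₁}|B′|)³M⁴exp(−(κ₁ − 1)M⁻⁴|Y∖□|), (1.39) where C₃ is an absolute constant. To cancel the factor
  1/g_k² we expand (1.38) with respect to B′ up to the second order. The terms of zeroth and first order vanish, and the
  second order term is written as a quadratic form with coefficients given by second order derivatives of the function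
  (1.38). The coefficients satisfy the bound |∫₀¹dt(1 − t) ∂²/(∂B′_μ(x)∂B′_ν(y)) ((1.38) with B′ replaced by tB′)|
  ≦ ½C₃3³e^{7·8κ₁}|B′| exp(−⅛(κ₁ − 1)d_k(Y) − ½(κ₁ − 1)M⁻⁴|Y|), (1.40) if e^{16κ₁}|B′| ≦ ⅓a₁. Taking B′ as in (1.19)
  we obtain the above bound with |B′|"* — p. 11 l. 1–4 — *"replaced by C₁ε₁. We fix a localization domain Y and we sum
  up all the expressions (1.38) with the domain Y, i.e. we sum over all admissible □ ⊂ Y. This yields an expression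
  satisfying the bounds (1.39), (1.40) with the additional factor M⁻⁴|Y| ≦ exp M⁻⁴|Y|."*
* p. 11, Lemma 2: *"The matrix elements of the operator of the quadratic form satisfy the bound
  |Q(Y, B, b, b′)| ≦ C₃ε₁M⁴ exp C₂κ₁ exp(−⅛(κ₁ − 1)d_k(Y) − ½(κ₁ − 1)M⁻⁴|Y|), (1.43)"* (typed verbatim as
  `B13.Bound143`).
* p. 16: *"The expression in the last exponential can be estimated using (1.42), and the inequalities (1.43), (1.36). We
  take a small, positive number α₄, to be chosen later, and 1/|τ(Y)| = E₀ε₁C₁α₄⁻¹M^q exp C₂κ₁ exp(−(1 − 3δ)κd_k(Y)).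
  (2.18) We assume that ⅛(κ₁ − 1) ≧ (1 − 3δ)κ, C₃ ≦ E₀C₁, and q ≧ 8. The quadratic form in (1.42), after
  multiplication by |τ(Y)|, can be bounded by
  ½ Σ_{b,b′⊂Y} α₄M⁻⁴exp(−¼(κ₁ − 1)M⁻⁴|Y| − (1/16)(κ₁ − 1)M⁻¹|b₋ − b′₋|)|B(b)||B(b′)|. (2.19)"* (the sentence
  *"We assume that …"* is the cell census restriction R12).
* p. 18, (2.30): *"(3·2³)⁻¹M⁻⁴|Y| ≦ d_k(Y) ≦ M⁻⁴|Y| − 1 (2.30)"* (upper half = `TreeLength.treeLen_le_card_sub_one`;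
  only the consequence d_k(Y) ≤ M⁻⁴|Y| is used below, as a hypothesis on two reals).

WHAT THIS FILE CERTIFIES (zero `sorry`; `n` stands for M⁻⁴|Y| = the number of cubes of π_k in Y, `d` for d_k(Y)).
* §1 `absorb143_rate`, `absorb143_rate_iff`, `oneShot_exp`, `sequential_obstruction` — THE RATE ARITHMETIC.  The factor
  e^{M⁻⁴|Y|} = e^n of p. 11 l. 1–4 is absorbed TOGETHER with (1.39)'s full coefficient e^{−(κ₁−1)M⁻⁴|Y∖□|} =
  e^{−(κ₁−1)(n−1)} into the printed exponent of (1.43): e^n·e^{−(κ₁−1)(n−1)} ≤ e^{κ₁−1}·exp(−⅛(κ₁−1)d − ½(κ₁−1)n)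
  whenever d ≤ n, n ≥ 0 and κ₁ ≥ 11/3 — and 11/3 is the EXACT threshold of this route (`absorb143_rate_iff`: the rate
  inequality for all 0 ≤ d ≤ n holds iff κ₁ ≥ 11/3).  The SEQUENTIAL reading (first (1.40) as printed, whose
  n-rate is already the printed ½(κ₁−1), then the factor e^n) would need e^n ≤ e^C uniformly in n — impossible
  (`sequential_obstruction`); so (1.43) holds as printed, but not by the literal two-step route, and NOT using C-B13-01's
  absorption hypothesis R10 (M⁴e^{κ₁−1} ≤ e^{8κ₁}) at all: the M⁴ of (1.39) is the M⁴ PRINTED in (1.43).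
* §2 `norm_Qsum_le_sharp`, `norm_Qsum_le_oneShot`, `norm_Qsum_le_shape143`, `floor_of_log`, `bound143_of_oneShot` — THE
  □-SUM.  For a finite family of per-cube terms `Fk i` (i ∈ s, #s ≤ n), each analytic on the polydisc and satisfying
  (1.39) with M⁻⁴|Y∖□| = n − 1, the summed Taylor coefficient obeys, for e^{16κ₁}‖B′‖ ≤ a₁/3 and unit directions,
  ‖Σ_i coeff‖ ≤ (27/2)·C₃·e^{49κ₁−1}·M⁴·‖B′‖·exp(−⅛(κ₁−1)d − ½(κ₁−1)n) (κ₁ ≥ 11/3), hence with ‖B′‖ ≤ C₁ε₁ and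
  the FLOOR (27/2)C₁e^{49κ₁−1} ≤ e^{C₂κ₁} EXACTLY the right side of (1.43) `C₃ε₁M⁴ exp C₂κ₁ exp(−⅛(κ₁−1)d − ½(κ₁−1)n)`;
  `floor_of_log`: the floor holds as soon as C₂ ≥ 49 + max(log(27C₁/2), 0) (κ₁ ≥ 1) — the sense in which print's
  *"exp C₂κ₁"* silently absorbs (1.39)'s (e^{16κ₁})³, the Cauchy-shell numeral ½·3³, the C₁ of (1.19) and the e^{κ₁−1}
  of the one-shot step (C₂ is the constant of (1.36), an upper-bound constant that may be enlarged); `bound143_of_oneShot`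
  transports a pointwise bound of the one-shot shape on the abstract carrier `B13.StepData` to the typed statement of
  record `B13.Bound143 S c` under the floor.
* §3 `R12`, `R25`, `R25_of_R12`, `R25_of_R12_R22`, `R26`, `R26_of_R21`, `R26_threshold` — RESTRICTION SUBSUMPTION
  (cell census R1–R24, `HOME/b2b-balaban-b13/transcript-B13.md`).  `R12` types the printed p. 16 sentence (its middle
  clause `C₃ ≤ E₀C₁` is the one quoted in `B13`'s Part G docstring); `R25 := 11/3 ≤ κ₁` (NOT PRINTED; the implicit
  restriction of §1, GAPS C-adv7-152) FOLLOWS from R12's rate clause once δ ≤ 1/10 (⇐ R22, `B13.Consts.delta_bounds_of_R22`)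
  and κ ≥ 1 (κ "sufficiently large", R13) — so the census gains no independent restriction; `R26 a₀ := Mα₀ ≤ a₀` is the
  SHAPE of the hypothesis of Theorem 3.1 of [13] = B9 (*"Mα₀ ≦ a₀"*, a₀ = a₀(d, L); GAPS C-adv7-153 (iii) asks whether
  B13's restriction list carries it): it FOLLOWS from the printed R21 first clause `(LM)⁴α₀ ≤ 1` (p. 20,
  `B13.Consts.R21`) once `a₀L⁴M³ ≥ 1`, i.e. for M beyond an a₀, L-dependent threshold (`R26_threshold`: M ≥ 1 and
  a₀L⁴M ≥ 1 suffice) — the same place in the admissible order (L → … → M → α's) as R1/R11/R24; second engine, in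
  the tree, to the NOT-proposed scratch `b2b-balaban-adv7/g62/Adv7G62.lean` (`ladder_B13_to_B12`, `ladder_B12_to_B9`)
  of GAPS C-adv7-155 (d), which reaches the same threshold *"for every M ≧ (a₀L⁴)^{−1/3}"* independently.
* §4 `invTau`, `elem219`, `rhs143`, `bound143_iff_rhs143`, `rhs143_le_invTau_mul_elem219`, `tau_mul_le_elem219`,
  `elem219_of_bound143` — THE CONSUMPTION OF (1.43) (p. 16, cell transcript CHECK l. 155, class P there, kernel here):
  |τ(Y)|·(right side of (1.43)) ≤ α₄M⁻⁴exp(−¼(κ₁−1)M⁻⁴|Y| − (1/16)(κ₁−1)M⁻¹|b₋ − b′₋|) = the matrix element of (2.19),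
  under R12 (all three clauses: the rate clause kills exp(+(1−3δ)κd − ⅛(κ₁−1)d), `C₃ ≤ E₀C₁` and `q ≥ 8` with M ≥ 1
  kill C₃M⁴/(E₀C₁M^q) ≤ M⁻⁴), κ₁ ≥ 1, d ≥ 0 and the GEOMETRIC INPUT G6 of the cell census as a hypothesis on reals
  (|b₋ − b′₋| ≤ 4M·M⁻⁴|Y| for b, b′ ⊂ Y, which turns ¼(κ₁−1)M⁻⁴|Y| into the printed (1/16)(κ₁−1)M⁻¹|b₋ − b′₋|).  The
  factor exp C₂κ₁ of (1.43) CANCELS identically against the exp C₂κ₁ of (2.18): the value of C₂ (hence of the floor of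
  §2) is immaterial downstream, provided (1.36), (1.43) and (2.18) carry the same C₂.
* §5 `fixedPoint_ball_linear`, `bound_118_linear` — NOT PRINTED, a what-if recorded for GAPS C-adv7-151 (LOW: B13 (1.4)
  omits the linear term −G̃Δ⁽²⁾H₀B′ of (180) of [15]; B13 (1.16) is quadratic in B′ — confirmed from the render by
  C-adv7-156 (c), which also certifies the printed constant 4 = 1 + 1 + 2 of (1.18) and its sharpness): if the fixed
  point A₀ carried an inhomogeneity of norm ≤ λ|B′| with λ ≤ b = B₀e^{16κ₁}, the arithmetic of (1.18) (pv20's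
  `B13Sect1Arith.bound_118`, constant 4) survives with constant 6 under R2, R3 and the strengthened R4′ `3bε₃ ≤ ε₂` —
  a second engine, on abstract reals, for those records' *"4 ↦ 4 + O(·) in (1.18)"* / *"no downstream bound breaks"*;
  nothing of [15]'s equation is modelled.
NOT certified here (hypotheses, by name in the docstrings): the analyticity of (1.38) and (1.39) themselves ([15]:
G-B13-01…05); Taylor's formula (that (1.38) EQUALS its second-order integral remainder — [folklore], as in `B13Ineq140`);
the identity M⁻⁴|Y∖□| = M⁻⁴|Y| − 1 (encoded by instantiating the (1.39) rate at n − 1); (2.30); G6; the extension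
*"in the same way for all terms in 𝐏^{(k)}"* (p. 11 l. 5–10, GAPS G-adv9-20 / C-adv7-147); the identification of the
(1.43) constant C₃ with (1.39)'s (print: *"possibly with other absolute constants"*).  MODELLING CONVENTIONS
(DIVERGENCE D-b13.32): as in `B13Ineq140` a B′-configuration is a point of a complex normed space `E`, (1.38) for the
cube □ = i is `Fk i : E → F`; the matrix element Q(Y, B, b, b′) is modelled by the finite sum over admissible cubes of the
printed coefficients `Σ_{i∈s} coeff140 (Fk i) B′ u v` in unit coordinate directions u, v of B′-space — the pull-back to
B-directions through B′ = g_kCB − hD(g_kCB) ((I.3.2) of [Balaban1987RG1] p. 270) and the 1/g_k² cancellation are the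
business of `B13PkScaling` and are NOT repeated; d_k(Y), M⁻⁴|Y|, |b₋ − b′₋| are reals carrying the printed inequalities
as hypotheses; norms of field functionals in §5 are abstract nonnegative reals.  VALUE: a located implicit restriction and
a by-hand census CHECK made kernel facts, with the restriction shown to be subsumed by the printed list; NOT a
certification of any disputed analytic step, NOT summit progress, NOT continuum, NOT Clay.
-/

noncomputable section

namespace Literature.MathematicalPhysics.QuantumFieldTheory.Balaban1983to89.B13Bound143

open Metric Set
open B13Ineq140 (Ineq139 coeff140 rad ineq140_sharp norm_sum_le_exp_card_mul)

/-! ## §1 The rate arithmetic of the one-shot absorption (p. 10 (1.39) + p. 11 l. 1–4 ⇒ the exponent of (1.43)) -/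

/-- **The one-shot rate inequality.**  With `n = M⁻⁴|Y| ≥ 0`, `d = d_k(Y) ≤ n` ((2.30)) and `κ₁ ≥ 11/3`:
`n + ⅛(κ₁ − 1)d + ½(κ₁ − 1)n ≤ (κ₁ − 1)n` — the cube-count factor e^n and the printed exponent of (1.43) are
together dominated by (1.39)'s full rate (κ₁ − 1)n (the remaining e^{κ₁−1} of (κ₁ − 1)(n − 1) is a constant).
Second engine to `Adv7G61.absorb143` (cell GAPS C-adv7-152). [cite: Balaban1988RG2Cluster, (1.39) p.10, (1.43) p.11] -/
theorem absorb143_rate {κ₁ d n : ℝ} (hκ : 11 / 3 ≤ κ₁) (hn : 0 ≤ n) (hd : d ≤ n) :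
    n + ((κ₁ - 1) / 8 * d + (κ₁ - 1) / 2 * n) ≤ (κ₁ - 1) * n := by
  have hk : 0 ≤ (κ₁ - 1) / 8 := by linarith
  have h1 : (κ₁ - 1) / 8 * d ≤ (κ₁ - 1) / 8 * n := mul_le_mul_of_nonneg_left hd hk
  nlinarith [mul_nonneg hn (show (0 : ℝ) ≤ κ₁ - 11 / 3 by linarith)]

/-- **11/3 is the exact threshold of the one-shot route**: the rate inequality of `absorb143_rate` holds for all
`0 ≤ n`, `d ≤ n` if and only if `κ₁ ≥ 11/3` (the instance `d = n = 1` forces it; GAPS C-adv7-152: *"the negative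
control with κ₁ ≧ 3 fails"*).  NOT a printed restriction — see `R25_of_R12` for its subsumption.
[cite: Balaban1988RG2Cluster, (1.43) p.11] -/
theorem absorb143_rate_iff (κ₁ : ℝ) :
    (∀ d n : ℝ, 0 ≤ n → d ≤ n → n + ((κ₁ - 1) / 8 * d + (κ₁ - 1) / 2 * n) ≤ (κ₁ - 1) * n) ↔ 11 / 3 ≤ κ₁ := by
  constructor
  · intro h
    have h1 := h 1 1 zero_le_one le_rfl
    linarith
  · intro hκ d n hn hd
    exact absorb143_rate hκ hn hd

/-- **The one-shot step in exponential form**: for `κ₁ ≥ 11/3`, `0 ≤ n`, `d ≤ n`,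
`e^n · e^{−(κ₁−1)(n−1)} ≤ e^{κ₁−1} · exp(−(⅛(κ₁−1)d + ½(κ₁−1)n))` — the factor *"M⁻⁴|Y| ≦ exp M⁻⁴|Y|"* of p. 11
times the rate factor of (1.39) (with M⁻⁴|Y∖□| = M⁻⁴|Y| − 1) is bounded by a constant times the printed exponential of
(1.43). [cite: Balaban1988RG2Cluster, p.11 l.1–4, (1.43) p.11] -/
theorem oneShot_exp {κ₁ d n : ℝ} (hκ : 11 / 3 ≤ κ₁) (hn : 0 ≤ n) (hd : d ≤ n) :
    Real.exp n * Real.exp (-(κ₁ - 1) * (n - 1)) ≤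
      Real.exp (κ₁ - 1) * Real.exp (-((κ₁ - 1) / 8 * d + (κ₁ - 1) / 2 * n)) := by
  rw [← Real.exp_add, ← Real.exp_add]
  apply Real.exp_le_exp.mpr
  have h := absorb143_rate hκ hn hd
  have e : -(κ₁ - 1) * (n - 1) = (κ₁ - 1) - (κ₁ - 1) * n := by ring
  rw [e]
  linarith

/-- **The sequential reading does not reproduce (1.43).**  If one first passes to (1.40) AS PRINTED (whose M⁻⁴|Y|-rate
is already the ½(κ₁ − 1) printed in (1.43)) and only then multiplies by the cube-count factor e^{M⁻⁴|Y|}, the factor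
e^n would have to be absorbed into a constant e^C uniformly in n ≥ 0, which is impossible: for every `C` there is an
`n ≥ 0` with `e^n · e^{−½(κ₁−1)n} > e^C · e^{−½(κ₁−1)n}`.  Second engine to `Adv7G61.sequential_loss` (GAPS C-adv7-152:
*"strictly worse than the printed ½(κ₁ − 1)"*). [cite: Balaban1988RG2Cluster, (1.40) p.10, (1.43) p.11] -/
theorem sequential_obstruction (κ₁ C : ℝ) :
    ∃ n : ℝ, 0 ≤ n ∧ ¬ (Real.exp n * Real.exp (-((κ₁ - 1) / 2) * n) ≤
      Real.exp C * Real.exp (-((κ₁ - 1) / 2) * n)) := by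
  refine ⟨max C 0 + 1, by positivity, fun h => ?_⟩
  have hpos : 0 < Real.exp (-((κ₁ - 1) / 2) * (max C 0 + 1)) := Real.exp_pos _
  have h1 : Real.exp (max C 0 + 1) ≤ Real.exp C := le_of_mul_le_mul_right h hpos
  have h2 : max C 0 + 1 ≤ C := Real.exp_le_exp.mp h1
  have h3 : C ≤ max C 0 := le_max_left _ _
  linarith

/-! ## §2 The □-sum: from (1.39) per admissible cube to the right side of (1.43) -/

section QSum

variable {E F : Type*} [NormedAddCommGroup E] [NormedSpace ℂ E]
  [NormedAddCommGroup F] [NormedSpace ℂ F]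

/-- **The summed coefficient, sharp form.**  A finite family of per-cube terms `Fk i`, `i ∈ s` (the admissible cubes
□ ⊂ Y, `#s ≤ n = M⁻⁴|Y|`), each analytic on the polydisc `‖B′‖ < a₁e^{−16κ₁}` and satisfying (1.39) with
M⁻⁴|Y∖□| = n − 1: for `e^{16κ₁}‖B′‖ ≤ a₁/3` and directions `‖u‖, ‖v‖ ≤ 1` the sum of the Taylor coefficients (1.40)
obeys `‖Σ_i coeff‖ ≤ e^n · ½C₃3³e^{48κ₁}·M⁴e^{−(κ₁−1)(n−1)}·‖B′‖` — pv20's `ineq140_sharp` per cube and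
`norm_sum_le_exp_card_mul` (*"the additional factor M⁻⁴|Y| ≦ exp M⁻⁴|Y|"*). [cite: Balaban1988RG2Cluster, (1.39)–(1.40) p.10, p.11 l.1–4] -/
theorem norm_Qsum_le_sharp {ι : Type*} (s : Finset ι) {Fk : ι → E → F} {κ₁ a₁ C₃ M n : ℝ}
    (ha₁ : 0 < a₁) (hC₃ : 0 ≤ C₃)
    (hF : ∀ i ∈ s, AnalyticOnNhd ℂ (Fk i) (ball 0 (rad κ₁ a₁)))
    (h139 : ∀ i ∈ s, Ineq139 (Fk i) κ₁ a₁ C₃ M (n - 1))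
    (hcard : (s.card : ℝ) ≤ n)
    {B' : E} (hB' : Real.exp (16 * κ₁) * ‖B'‖ ≤ a₁ / 3) {u v : E} (hu : ‖u‖ ≤ 1) (hv : ‖v‖ ≤ 1) :
    ‖∑ i ∈ s, coeff140 (Fk i) B' u v‖ ≤
      Real.exp n * (1 / 2 * C₃ * 3 ^ 3 * Real.exp (48 * κ₁) *
        (M ^ 4 * Real.exp (-(κ₁ - 1) * (n - 1))) * ‖B'‖) := by
  have hM4 : 0 ≤ M ^ 4 := by positivity
  have hb : 0 ≤ 1 / 2 * C₃ * 3 ^ 3 * Real.exp (48 * κ₁) *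
      (M ^ 4 * Real.exp (-(κ₁ - 1) * (n - 1))) * ‖B'‖ := by positivity
  have h := norm_sum_le_exp_card_mul s (fun i => coeff140 (Fk i) B' u v) hb
    (fun i hi => ineq140_sharp ha₁ hC₃ (hF i hi) (h139 i hi) hB' hu hv)
  refine h.trans ?_
  have he : Real.exp (s.card : ℝ) ≤ Real.exp n := Real.exp_le_exp.mpr hcard
  exact mul_le_mul_of_nonneg_right he hb

/-- **The summed coefficient after the one-shot absorption** (`κ₁ ≥ 11/3`, `0 ≤ n`, `d ≤ n`):
`‖Σ_i coeff‖ ≤ (27/2)·C₃·e^{49κ₁−1}·M⁴·‖B′‖·exp(−(⅛(κ₁−1)d + ½(κ₁−1)n))` — the printed exponent of (1.43) with the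
M⁴ of (1.39) kept (no absorption hypothesis on M). [cite: Balaban1988RG2Cluster, (1.39) p.10, (1.43) p.11] -/
theorem norm_Qsum_le_oneShot {ι : Type*} (s : Finset ι) {Fk : ι → E → F} {κ₁ a₁ C₃ M n d : ℝ}
    (ha₁ : 0 < a₁) (hC₃ : 0 ≤ C₃) (hκ : 11 / 3 ≤ κ₁) (hn : 0 ≤ n) (hd : d ≤ n)
    (hF : ∀ i ∈ s, AnalyticOnNhd ℂ (Fk i) (ball 0 (rad κ₁ a₁)))
    (h139 : ∀ i ∈ s, Ineq139 (Fk i) κ₁ a₁ C₃ M (n - 1))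
    (hcard : (s.card : ℝ) ≤ n)
    {B' : E} (hB' : Real.exp (16 * κ₁) * ‖B'‖ ≤ a₁ / 3) {u v : E} (hu : ‖u‖ ≤ 1) (hv : ‖v‖ ≤ 1) :
    ‖∑ i ∈ s, coeff140 (Fk i) B' u v‖ ≤
      27 / 2 * C₃ * Real.exp (49 * κ₁ - 1) * M ^ 4 * ‖B'‖ *
        Real.exp (-((κ₁ - 1) / 8 * d + (κ₁ - 1) / 2 * n)) := by
  have h := norm_Qsum_le_sharp s ha₁ hC₃ hF h139 hcard hB' hu hv
  have h2 := oneShot_exp hκ hn hd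
  have hM4 : 0 ≤ M ^ 4 := by positivity
  have e1 : Real.exp n * (1 / 2 * C₃ * 3 ^ 3 * Real.exp (48 * κ₁) *
      (M ^ 4 * Real.exp (-(κ₁ - 1) * (n - 1))) * ‖B'‖) =
      (27 / 2 * C₃ * Real.exp (48 * κ₁) * M ^ 4 * ‖B'‖) *
        (Real.exp n * Real.exp (-(κ₁ - 1) * (n - 1))) := by ring
  have e49 : Real.exp (49 * κ₁ - 1) = Real.exp (48 * κ₁) * Real.exp (κ₁ - 1) := by
    rw [← Real.exp_add]; congr 1; ring
  have e2 : 27 / 2 * C₃ * Real.exp (49 * κ₁ - 1) * M ^ 4 * ‖B'‖ *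
      Real.exp (-((κ₁ - 1) / 8 * d + (κ₁ - 1) / 2 * n)) =
      (27 / 2 * C₃ * Real.exp (48 * κ₁) * M ^ 4 * ‖B'‖) *
        (Real.exp (κ₁ - 1) * Real.exp (-((κ₁ - 1) / 8 * d + (κ₁ - 1) / 2 * n))) := by
    rw [e49]; ring
  rw [e2]
  rw [e1] at h
  have hc : 0 ≤ 27 / 2 * C₃ * Real.exp (48 * κ₁) * M ^ 4 * ‖B'‖ := by positivity
  exact h.trans (mul_le_mul_of_nonneg_left h2 hc)

/-- **The right side of (1.43) reached.**  Under the data of `norm_Qsum_le_oneShot`, *"|B′| replaced by C₁ε₁"*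
(p. 11 l. 1, `‖B′‖ ≤ C₁ε₁`, `ε₁ ≥ 0`) and the FLOOR `(27/2)·C₁·e^{49κ₁−1} ≤ e^{C₂κ₁}` (implicit in print's
*"exp C₂κ₁"*; `floor_of_log`): `‖Σ_i coeff‖ ≤ C₃ε₁M⁴ exp C₂κ₁ exp(−(⅛(κ₁−1)d + ½(κ₁−1)n))` — letter for letter the
right side of (1.43) as typed in `B13.Bound143`. [cite: Balaban1988RG2Cluster, (1.43) p.11] -/
theorem norm_Qsum_le_shape143 {ι : Type*} (s : Finset ι) {Fk : ι → E → F} {κ₁ a₁ C₁ C₂ C₃ M n d ε₁ : ℝ}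
    (ha₁ : 0 < a₁) (hC₃ : 0 ≤ C₃) (hε₁ : 0 ≤ ε₁) (hκ : 11 / 3 ≤ κ₁) (hn : 0 ≤ n) (hd : d ≤ n)
    (hfloor : 27 / 2 * C₁ * Real.exp (49 * κ₁ - 1) ≤ Real.exp (C₂ * κ₁))
    (hF : ∀ i ∈ s, AnalyticOnNhd ℂ (Fk i) (ball 0 (rad κ₁ a₁)))
    (h139 : ∀ i ∈ s, Ineq139 (Fk i) κ₁ a₁ C₃ M (n - 1))
    (hcard : (s.card : ℝ) ≤ n)
    {B' : E} (hB' : Real.exp (16 * κ₁) * ‖B'‖ ≤ a₁ / 3) (hB'C : ‖B'‖ ≤ C₁ * ε₁)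
    {u v : E} (hu : ‖u‖ ≤ 1) (hv : ‖v‖ ≤ 1) :
    ‖∑ i ∈ s, coeff140 (Fk i) B' u v‖ ≤
      C₃ * ε₁ * M ^ 4 * Real.exp (C₂ * κ₁) * Real.exp (-((κ₁ - 1) / 8 * d + (κ₁ - 1) / 2 * n)) := by
  have h := norm_Qsum_le_oneShot s ha₁ hC₃ hκ hn hd hF h139 hcard hB' hu hv
  have hM4 : 0 ≤ M ^ 4 := by positivity
  set X : ℝ := Real.exp (-((κ₁ - 1) / 8 * d + (κ₁ - 1) / 2 * n)) with hX
  have hX0 : 0 ≤ X := (Real.exp_pos _).le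
  have hc1 : 0 ≤ 27 / 2 * C₃ * Real.exp (49 * κ₁ - 1) * M ^ 4 := by positivity
  -- |B′| ↦ C₁ε₁
  have h1 : 27 / 2 * C₃ * Real.exp (49 * κ₁ - 1) * M ^ 4 * ‖B'‖ * X ≤
      27 / 2 * C₃ * Real.exp (49 * κ₁ - 1) * M ^ 4 * (C₁ * ε₁) * X :=
    mul_le_mul_of_nonneg_right (mul_le_mul_of_nonneg_left hB'C hc1) hX0
  -- the floor
  have hY : 0 ≤ C₃ * ε₁ * M ^ 4 * X := by positivity
  have h2 : 27 / 2 * C₃ * Real.exp (49 * κ₁ - 1) * M ^ 4 * (C₁ * ε₁) * X ≤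
      C₃ * ε₁ * M ^ 4 * Real.exp (C₂ * κ₁) * X := by
    calc 27 / 2 * C₃ * Real.exp (49 * κ₁ - 1) * M ^ 4 * (C₁ * ε₁) * X
        = (27 / 2 * C₁ * Real.exp (49 * κ₁ - 1)) * (C₃ * ε₁ * M ^ 4 * X) := by ring
      _ ≤ Real.exp (C₂ * κ₁) * (C₃ * ε₁ * M ^ 4 * X) := mul_le_mul_of_nonneg_right hfloor hY
      _ = C₃ * ε₁ * M ^ 4 * Real.exp (C₂ * κ₁) * X := by ring
  exact h.trans (h1.trans h2)

end QSum

/-- **The floor behind "exp C₂κ₁".**  For `κ₁ ≥ 1`, `C₁ > 0` and `C₂ ≥ 49 + max(log(27C₁/2), 0)` one has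
`(27/2)·C₁·e^{49κ₁−1} ≤ e^{C₂κ₁}`: the (e^{16κ₁})³ of (1.39), the Cauchy numeral ½·3³ of (1.40), the C₁ of (1.19)
and the e^{κ₁−1} of the one-shot step all fit into the printed exp C₂κ₁ after enlarging the (1.36)-constant C₂ (an
upper-bound constant).  Pure arithmetic; the enlargement is implicit in print. [cite: Balaban1988RG2Cluster, (1.43) p.11] -/
theorem floor_of_log {C₁ C₂ κ₁ : ℝ} (hκ : 1 ≤ κ₁) (hC₁ : 0 < C₁)
    (hC₂ : 49 + max (Real.log (27 / 2 * C₁)) 0 ≤ C₂) :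
    27 / 2 * C₁ * Real.exp (49 * κ₁ - 1) ≤ Real.exp (C₂ * κ₁) := by
  have hpos : 0 < 27 / 2 * C₁ := by positivity
  have hl : Real.log (27 / 2 * C₁) ≤ max (Real.log (27 / 2 * C₁)) 0 := le_max_left _ _
  have hm : 0 ≤ max (Real.log (27 / 2 * C₁)) 0 := le_max_right _ _
  have h1 : max (Real.log (27 / 2 * C₁)) 0 ≤ κ₁ * max (Real.log (27 / 2 * C₁)) 0 :=
    le_mul_of_one_le_left hm hκ
  have h2 : (49 + max (Real.log (27 / 2 * C₁)) 0) * κ₁ ≤ C₂ * κ₁ :=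
    mul_le_mul_of_nonneg_right hC₂ (by linarith)
  calc 27 / 2 * C₁ * Real.exp (49 * κ₁ - 1)
      = Real.exp (Real.log (27 / 2 * C₁) + (49 * κ₁ - 1)) := by
        rw [Real.exp_add, Real.exp_log hpos]
    _ ≤ Real.exp (C₂ * κ₁) := by
        apply Real.exp_le_exp.mpr
        nlinarith

/-- **Transport to the statement of record.**  On the abstract carrier of `B13` (`S : B13.StepData`, constants
`c : B13.Consts`): if every matrix element `S.Q Y φ b b′` (φ in the space (1.34) of Y) obeys a bound of the ONE-SHOT
SHAPE `(27/2)·C₃·e^{49κ₁−1}·M⁴·(C₁ε₁)·exp(−(⅛(κ₁−1)d_k(Y) + ½(κ₁−1)M⁻⁴|Y|))` (the conclusion of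
`norm_Qsum_le_oneShot` with ‖B′‖ ≤ C₁ε₁), then under the floor the typed (1.43) `B13.Bound143 S c` holds.  Pure
bookkeeping; the pointwise bound is the hypothesis. [cite: Balaban1988RG2Cluster, (1.43) p.11] -/
theorem bound143_of_oneShot (S : B13.StepData) (c : B13.Consts) (hε₁ : 0 ≤ c.ε₁) (hC₃ : 0 ≤ c.C₃)
    (hfloor : 27 / 2 * c.C₁ * Real.exp (49 * c.κ₁ - 1) ≤ Real.exp (c.C₂ * c.κ₁))
    (h : ∀ Y φ (b b' : S.Bond), φ ∈ S.sp1 Y → ‖S.Q Y φ b b'‖ ≤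
      27 / 2 * c.C₃ * Real.exp (49 * c.κ₁ - 1) * c.M ^ 4 * (c.C₁ * c.ε₁) *
        Real.exp (-((c.κ₁ - 1) / 8 * S.Dk.dj Y + (c.κ₁ - 1) / 2 * (S.volk Y : ℝ)))) :
    B13.Bound143 S c := by
  unfold B13.Bound143
  intro Y φ b b' hφ
  refine (h Y φ b b' hφ).trans ?_
  have hM4 : 0 ≤ c.M ^ 4 := by positivity
  set X : ℝ := Real.exp (-((c.κ₁ - 1) / 8 * S.Dk.dj Y + (c.κ₁ - 1) / 2 * (S.volk Y : ℝ))) with hX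
  have hY : 0 ≤ c.C₃ * c.ε₁ * c.M ^ 4 * X := by positivity
  calc 27 / 2 * c.C₃ * Real.exp (49 * c.κ₁ - 1) * c.M ^ 4 * (c.C₁ * c.ε₁) * X
      = (27 / 2 * c.C₁ * Real.exp (49 * c.κ₁ - 1)) * (c.C₃ * c.ε₁ * c.M ^ 4 * X) := by ring
    _ ≤ Real.exp (c.C₂ * c.κ₁) * (c.C₃ * c.ε₁ * c.M ^ 4 * X) := mul_le_mul_of_nonneg_right hfloor hY
    _ = c.C₃ * c.ε₁ * c.M ^ 4 * Real.exp (c.C₂ * c.κ₁) * X := by ring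

/-! ## §3 Restriction subsumption: R12 (printed, p. 16), R25 := κ₁ ≥ 11/3 and R26 := Mα₀ ≤ a₀ (not printed) -/

/-- **R12** (cell census), p. 16 [16], verbatim: *"We assume that ⅛(κ₁ − 1) ≧ (1 − 3δ)κ, C₃ ≦ E₀C₁, and q ≧ 8."* —
all three clauses (C₃ = the absolute constant of (1.39)/(1.43), `B13.Consts.C₃`; the middle clause is the one quoted in
`B13`'s Part G docstring). [cite: Balaban1988RG2Cluster, p.16 (after (2.18))] -/
def R12 (c : B13.Consts) : Prop :=
  (1 - 3 * c.δ) * c.κ ≤ (c.κ₁ - 1) / 8 ∧ c.C₃ ≤ c.E₀ * c.C₁ ∧ 8 ≤ c.q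

/-- **R25** (NOT PRINTED): `κ₁ ≥ 11/3`, the implicit restriction of the one-shot route to (1.43) (`absorb143_rate_iff`;
cell GAPS C-adv7-152).  It is not an independent restriction: `R25_of_R12`. [cite: Balaban1988RG2Cluster, (1.43) p.11] -/
def R25 (c : B13.Consts) : Prop := 11 / 3 ≤ c.κ₁

/-- **R25 ⊂ R12.**  The printed rate clause `(1 − 3δ)κ ≤ ⅛(κ₁ − 1)` with `δ ≤ 1/10` (p. 21 R22 gives
δ = (1 − 2L⁻¹)/10 < 1/10, `B13.Consts.delta_bounds_of_R22`) and `κ ≥ 1` (κ is taken large: (1.26) *"for κ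
sufficiently large"*, census R13) gives κ₁ ≥ 1 + 8·(7/10) = 6.6 ≥ 11/3. [cite: Balaban1988RG2Cluster, p.16 (after (2.18)), (1.43) p.11] -/
theorem R25_of_R12 (c : B13.Consts) (h12 : R12 c) (hδ : c.δ ≤ 1 / 10) (hκ : 1 ≤ c.κ) : R25 c := by
  obtain ⟨h, -, -⟩ := h12
  unfold R25
  have h7 : (7 / 10 : ℝ) ≤ (1 - 3 * c.δ) * c.κ := by
    nlinarith [mul_nonneg (show (0 : ℝ) ≤ 3 / 10 - 3 * c.δ by linarith) (show (0 : ℝ) ≤ c.κ by linarith)]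
  linarith

/-- **R25 from the printed R12 and R22** (L > 2, κ ≥ 1). [cite: Balaban1988RG2Cluster, p.16 (after (2.18)), p.21 (after (2.41))] -/
theorem R25_of_R12_R22 (c : B13.Consts) (h12 : R12 c) (h22 : c.R22) (hL : 2 < (c.L : ℝ)) (hκ : 1 ≤ c.κ) :
    R25 c :=
  R25_of_R12 c h12 (B13.Consts.delta_bounds_of_R22 c hL h22).2.le hκ

/-- **R26** (NOT PRINTED in [II]; the SHAPE of the hypothesis *"Mα₀ ≦ a₀"* of Theorem 3.1 of [13] = B9, whose constants
a₀, B₀, δ₀, M₁ depend on d and L only — cell GAPS C-adv7-153 (iii) asks whether the restriction list of Lemma 3 / [I]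
carries it).  `a₀` is an abstract positive parameter fixed before M; the identification of [13]'s cube size M with this
paper's M is the reading of that record, not asserted here. [cite: Balaban1988RG2Cluster, p.20 (before the definition of C₃)] -/
def R26 (c : B13.Consts) (a₀ : ℝ) : Prop := c.M * c.α₀ ≤ a₀

/-- **R26 ⊂ R21.**  The printed p. 20 restriction `(LM)⁴α₀ ≤ 1` (first clause of `B13.Consts.R21`) gives
`Mα₀ ≤ (L⁴M³)⁻¹ ≤ a₀` as soon as `a₀L⁴M³ ≥ 1` — an "M sufficiently large" threshold depending on a₀ and L, at the same
place of the admissible order (L → δ → κ → κ₁ → M → α's) as the printed R1, R11, R24.  Second engine to the scratch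
`Adv7G62.ladder_B12_to_B9` of cell GAPS C-adv7-155 (d) (*"a₀/α₀ ≧ a₀L⁴M⁴ ≧ M iff a₀L⁴M³ ≧ 1"*).
[cite: Balaban1988RG2Cluster, p.20 (before the definition of C₃)] -/
theorem R26_of_R21 (c : B13.Consts) {a₀ : ℝ} (h21 : c.R21) (hL : 0 < (c.L : ℝ)) (hM : 0 < c.M)
    (ha : 1 ≤ a₀ * ((c.L : ℝ) ^ 4 * c.M ^ 3)) : R26 c a₀ := by
  obtain ⟨h0, -, -, -⟩ := h21
  unfold R26
  have hpos : 0 < (c.L : ℝ) ^ 4 * c.M ^ 3 := by positivity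
  have key : c.M * c.α₀ * ((c.L : ℝ) ^ 4 * c.M ^ 3) ≤ a₀ * ((c.L : ℝ) ^ 4 * c.M ^ 3) := by
    calc c.M * c.α₀ * ((c.L : ℝ) ^ 4 * c.M ^ 3) = ((c.L : ℝ) * c.M) ^ 4 * c.α₀ := by ring
      _ ≤ 1 := h0
      _ ≤ a₀ * ((c.L : ℝ) ^ 4 * c.M ^ 3) := ha
  exact le_of_mul_le_mul_right key hpos

/-- The threshold of `R26_of_R21` is an "M sufficiently large" condition: `M ≥ 1` and `a₀L⁴M ≥ 1` give
`a₀L⁴M³ ≥ 1`. [folklore] -/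
theorem R26_threshold (c : B13.Consts) {a₀ : ℝ} (hM : 1 ≤ c.M)
    (h : 1 ≤ a₀ * (c.L : ℝ) ^ 4 * c.M) : 1 ≤ a₀ * ((c.L : ℝ) ^ 4 * c.M ^ 3) := by
  have hM2 : 1 ≤ c.M ^ 2 := by nlinarith
  have h0 : 0 ≤ a₀ * (c.L : ℝ) ^ 4 * c.M := zero_le_one.trans h
  calc (1 : ℝ) ≤ a₀ * (c.L : ℝ) ^ 4 * c.M := h
    _ ≤ a₀ * (c.L : ℝ) ^ 4 * c.M * c.M ^ 2 := le_mul_of_one_le_right h0 hM2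
    _ = a₀ * ((c.L : ℝ) ^ 4 * c.M ^ 3) := by ring

/-! ## §4 The consumption of (1.43): (2.18), R12, G6 ⇒ the matrix element of (2.19) (p. 16) -/

/-- **(2.18)** p. 16 [16], verbatim: *"1/|τ(Y)| = E₀ε₁C₁α₄⁻¹M^q exp C₂κ₁ exp(−(1 − 3δ)κd_k(Y))"* — as a real
function of `d = d_k(Y)` over the constants record. [cite: Balaban1988RG2Cluster, (2.18) p.16] -/
def invTau (c : B13.Consts) (d : ℝ) : ℝ :=
  c.E₀ * c.ε₁ * c.C₁ * c.α₄⁻¹ * c.M ^ c.q * Real.exp (c.C₂ * c.κ₁) * Real.exp (-(1 - 3 * c.δ) * c.κ * d)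

/-- The matrix element of **(2.19)** p. 16 [16], verbatim: *"α₄M⁻⁴exp(−¼(κ₁ − 1)M⁻⁴|Y| − (1/16)(κ₁ − 1)M⁻¹|b₋ − b′₋|)"*
(`n` = M⁻⁴|Y|, `dist` = |b₋ − b′₋|; the printed ½ and |B(b)||B(b′)| belong to the quadratic form ½⟨Q B, B⟩ of (1.42)).
[cite: Balaban1988RG2Cluster, (2.19) p.16] -/
def elem219 (c : B13.Consts) (n dist : ℝ) : ℝ :=
  c.α₄ * (c.M ^ 4)⁻¹ * Real.exp (-(1 / 4) * (c.κ₁ - 1) * n - 1 / 16 * (c.κ₁ - 1) * (c.M⁻¹ * dist))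

/-- The right side of **(1.43)** as a real function of `d = d_k(Y)`, `n = M⁻⁴|Y|` (`bound143_iff_rhs143`).
[cite: Balaban1988RG2Cluster, (1.43) p.11] -/
def rhs143 (c : B13.Consts) (d n : ℝ) : ℝ :=
  c.C₃ * c.ε₁ * c.M ^ 4 * Real.exp (c.C₂ * c.κ₁) * Real.exp (-((c.κ₁ - 1) / 8 * d + (c.κ₁ - 1) / 2 * n))

/-- `B13.Bound143 S c` is, definitionally, the pointwise bound of the matrix elements by `rhs143 c (d_k Y) (M⁻⁴|Y|)`.
[cite: Balaban1988RG2Cluster, (1.43) p.11] -/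
theorem bound143_iff_rhs143 (S : B13.StepData) (c : B13.Consts) :
    B13.Bound143 S c ↔
      ∀ Y φ (b b' : S.Bond), φ ∈ S.sp1 Y → ‖S.Q Y φ b b'‖ ≤ rhs143 c (S.Dk.dj Y) (S.volk Y : ℝ) :=
  Iff.rfl

/-- `1/|τ(Y)| > 0` for positive E₀, ε₁, C₁, α₄, M. [cite: Balaban1988RG2Cluster, (2.18) p.16] -/
theorem invTau_pos (c : B13.Consts) (hE : 0 < c.E₀) (hε : 0 < c.ε₁) (hC₁ : 0 < c.C₁) (hα : 0 < c.α₄)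
    (hM : 0 < c.M) (d : ℝ) : 0 < invTau c d := by
  unfold invTau; positivity

/-- **The factorwise comparison behind (2.19).**  Under R12 (all three clauses), `C₃ ≥ 0`, `E₀, C₁, α₄ > 0`, `ε₁ ≥ 0`,
`M ≥ 1`, `κ₁ ≥ 1`, `d ≥ 0` and the geometric input G6 `|b₋ − b′₋| ≤ 4M·M⁻⁴|Y|` (b, b′ ⊂ Y; cell census G6):
`(right side of (1.43)) ≤ (1/|τ(Y)|) · (matrix element of (2.19))`.  Mechanism (cell transcript CHECK l. 155): the
exp C₂κ₁'s CANCEL; C₃M⁴ ≤ E₀C₁·M^q·M⁻⁴ by `C₃ ≤ E₀C₁`, `q ≥ 8`, `M ≥ 1`; −⅛(κ₁−1)d ≤ −(1−3δ)κd by the rate clause;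
−½(κ₁−1)n = −¼(κ₁−1)n − ¼(κ₁−1)n and ¼(κ₁−1)n ≥ (1/16)(κ₁−1)M⁻¹|b₋ − b′₋| by G6. [cite: Balaban1988RG2Cluster, (2.18)–(2.19) p.16, (1.43) p.11] -/
theorem rhs143_le_invTau_mul_elem219 (c : B13.Consts) (h12 : R12 c) (hC₃ : 0 ≤ c.C₃) (hE : 0 < c.E₀)
    (hε : 0 ≤ c.ε₁) (hC₁ : 0 < c.C₁) (hα : 0 < c.α₄) (hM : 1 ≤ c.M) (hκ₁ : 1 ≤ c.κ₁)
    {d n dist : ℝ} (hd : 0 ≤ d) (hG6 : dist ≤ 4 * c.M * n) :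
    rhs143 c d n ≤ invTau c d * elem219 c n dist := by
  obtain ⟨hrate, hC, hq⟩ := h12
  have hM0 : 0 < c.M := by linarith
  have hM4 : 0 < c.M ^ 4 := by positivity
  -- the exponents
  have hA : -((c.κ₁ - 1) / 8 * d + (c.κ₁ - 1) / 2 * n) ≤
      -(1 - 3 * c.δ) * c.κ * d +
        (-(1 / 4) * (c.κ₁ - 1) * n - 1 / 16 * (c.κ₁ - 1) * (c.M⁻¹ * dist)) := by
    have e1 : (1 - 3 * c.δ) * c.κ * d ≤ (c.κ₁ - 1) / 8 * d := mul_le_mul_of_nonneg_right hrate hd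
    have e2 : c.M⁻¹ * dist ≤ 4 * n := by
      calc c.M⁻¹ * dist ≤ c.M⁻¹ * (4 * c.M * n) :=
            mul_le_mul_of_nonneg_left hG6 (inv_nonneg.mpr hM0.le)
        _ = 4 * n := by field_simp
    have e3 : 1 / 16 * (c.κ₁ - 1) * (c.M⁻¹ * dist) ≤ 1 / 16 * (c.κ₁ - 1) * (4 * n) :=
      mul_le_mul_of_nonneg_left e2 (by linarith)
    linarith
  -- the constants
  have hK : c.C₃ * c.M ^ 4 ≤ c.E₀ * c.C₁ * (c.M ^ c.q * (c.M ^ 4)⁻¹) := by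
    have hMq : c.M ^ 4 * c.M ^ 4 ≤ c.M ^ c.q := by
      rw [← pow_add]; exact pow_le_pow_right₀ hM (by omega)
    have h3 : c.C₃ * c.M ^ 4 * c.M ^ 4 ≤ c.E₀ * c.C₁ * c.M ^ c.q := by
      calc c.C₃ * c.M ^ 4 * c.M ^ 4 = c.C₃ * (c.M ^ 4 * c.M ^ 4) := by ring
        _ ≤ c.C₃ * c.M ^ c.q := mul_le_mul_of_nonneg_left hMq hC₃
        _ ≤ c.E₀ * c.C₁ * c.M ^ c.q := mul_le_mul_of_nonneg_right hC (by positivity)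
    calc c.C₃ * c.M ^ 4 = c.C₃ * c.M ^ 4 * c.M ^ 4 * (c.M ^ 4)⁻¹ := by field_simp
      _ ≤ c.E₀ * c.C₁ * c.M ^ c.q * (c.M ^ 4)⁻¹ :=
          mul_le_mul_of_nonneg_right h3 (inv_nonneg.mpr hM4.le)
      _ = c.E₀ * c.C₁ * (c.M ^ c.q * (c.M ^ 4)⁻¹) := by ring
  -- the two sides factored
  have eL : rhs143 c d n = c.C₃ * c.M ^ 4 * (c.ε₁ * Real.exp (c.C₂ * c.κ₁)) *
      Real.exp (-((c.κ₁ - 1) / 8 * d + (c.κ₁ - 1) / 2 * n)) := by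
    unfold rhs143; ring
  have hα1 : c.α₄⁻¹ * c.α₄ = 1 := inv_mul_cancel₀ hα.ne'
  have eR : invTau c d * elem219 c n dist =
      c.E₀ * c.C₁ * (c.M ^ c.q * (c.M ^ 4)⁻¹) * (c.ε₁ * Real.exp (c.C₂ * c.κ₁)) *
        Real.exp (-(1 - 3 * c.δ) * c.κ * d +
          (-(1 / 4) * (c.κ₁ - 1) * n - 1 / 16 * (c.κ₁ - 1) * (c.M⁻¹ * dist))) := by
    unfold invTau elem219
    rw [Real.exp_add]
    calc _ = (c.α₄⁻¹ * c.α₄) * (c.E₀ * c.C₁ * (c.M ^ c.q * (c.M ^ 4)⁻¹) *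
          (c.ε₁ * Real.exp (c.C₂ * c.κ₁)) * (Real.exp (-(1 - 3 * c.δ) * c.κ * d) *
            Real.exp (-(1 / 4) * (c.κ₁ - 1) * n - 1 / 16 * (c.κ₁ - 1) * (c.M⁻¹ * dist)))) := by ring
      _ = _ := by rw [hα1, one_mul]
  rw [eL, eR]
  have hmid : 0 ≤ c.ε₁ * Real.exp (c.C₂ * c.κ₁) := by positivity
  have hB0 : 0 ≤ c.E₀ * c.C₁ * (c.M ^ c.q * (c.M ^ 4)⁻¹) * (c.ε₁ * Real.exp (c.C₂ * c.κ₁)) := by positivity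
  exact mul_le_mul (mul_le_mul_of_nonneg_right hK hmid) (Real.exp_le_exp.mpr hA) (Real.exp_pos _).le hB0

/-- **(1.43) × |τ(Y)| ≤ the matrix element of (2.19)** (p. 16: *"The quadratic form in (1.42), after multiplication by
|τ(Y)|, can be bounded by … (2.19)"*): for a nonnegative real `Qabs` (= |Q(Y, B, b, b′)|) obeying the right side of
(1.43), `|τ(Y)|·Qabs = (1/|τ(Y)|)⁻¹·Qabs ≤ α₄M⁻⁴exp(−¼(κ₁−1)M⁻⁴|Y| − (1/16)(κ₁−1)M⁻¹|b₋ − b′₋|)`, under R12,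
κ₁ ≥ 1, M ≥ 1, positive E₀, ε₁, C₁, α₄, C₃ ≥ 0, d_k(Y) ≥ 0 and G6.  Cell transcript CHECK l. 155 (class P) made
kernel. [cite: Balaban1988RG2Cluster, (2.18)–(2.19) p.16] -/
theorem tau_mul_le_elem219 (c : B13.Consts) (h12 : R12 c) (hC₃ : 0 ≤ c.C₃) (hE : 0 < c.E₀)
    (hε : 0 < c.ε₁) (hC₁ : 0 < c.C₁) (hα : 0 < c.α₄) (hM : 1 ≤ c.M) (hκ₁ : 1 ≤ c.κ₁)
    {d n dist : ℝ} (hd : 0 ≤ d) (hG6 : dist ≤ 4 * c.M * n) {Qabs : ℝ} (hQ : Qabs ≤ rhs143 c d n) :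
    (invTau c d)⁻¹ * Qabs ≤ elem219 c n dist := by
  have hτ : 0 < invTau c d := invTau_pos c hE hε hC₁ hα (by linarith) d
  have h := hQ.trans (rhs143_le_invTau_mul_elem219 c h12 hC₃ hE hε.le hC₁ hα hM hκ₁ hd hG6)
  calc (invTau c d)⁻¹ * Qabs ≤ (invTau c d)⁻¹ * (invTau c d * elem219 c n dist) :=
        mul_le_mul_of_nonneg_left h (inv_nonneg.mpr hτ.le)
    _ = elem219 c n dist := by rw [← mul_assoc, inv_mul_cancel₀ hτ.ne', one_mul]

/-- **From the statement of record.**  `B13.Bound143 S c` (the typed (1.43)) gives, for every Y, every φ in the space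
(1.34) of Y and all bonds b, b′ whose distance datum obeys G6 relative to Y, the (2.19) matrix-element bound after
multiplication by |τ(Y)| (d_k(Y) ≥ 0 is `Setup.LocDomainSys.dj_nonneg`). [cite: Balaban1988RG2Cluster, (2.19) p.16, (1.43) p.11] -/
theorem elem219_of_bound143 (S : B13.StepData) (c : B13.Consts) (h143 : B13.Bound143 S c) (h12 : R12 c)
    (hC₃ : 0 ≤ c.C₃) (hE : 0 < c.E₀) (hε : 0 < c.ε₁) (hC₁ : 0 < c.C₁) (hα : 0 < c.α₄) (hM : 1 ≤ c.M)
    (hκ₁ : 1 ≤ c.κ₁) (Y : S.Dk.Dom) (φ : S.Φ) (b b' : S.Bond) (hφ : φ ∈ S.sp1 Y)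
    {dist : ℝ} (hG6 : dist ≤ 4 * c.M * (S.volk Y : ℝ)) :
    (invTau c (S.Dk.dj Y))⁻¹ * ‖S.Q Y φ b b'‖ ≤ elem219 c (S.volk Y : ℝ) dist :=
  tau_mul_le_elem219 c h12 hC₃ hE hε hC₁ hα hM hκ₁ (S.Dk.dj_nonneg Y) hG6 (h143 Y φ b b' hφ)

/-! ## §5 NOT PRINTED — the (1.16)/(1.18) arithmetic with a linear inhomogeneity (what-if for GAPS C-adv7-151) -/

/-- **Fixed point in the ball, with an inhomogeneity** (NOT PRINTED).  If `a = |A₀|` obeys the fixed-point estimate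
`a ≤ λx + K(bx + a)²` (x = |B′|, the quadratic part as in the derivation of (1.16) p. 6, plus a linear inhomogeneity
of norm ≤ λx) and lies in the ball `a ≤ bx`, then `a ≤ λx + 4Kb²x²` — the shape of (1.16) plus the linear term.
[folklore] -/
theorem fixedPoint_ball_linear {a b x lam K : ℝ} (hK : 0 ≤ K) (hb : 0 ≤ b) (hx : 0 ≤ x) (ha0 : 0 ≤ a)
    (hfix : a ≤ lam * x + K * (b * x + a) ^ 2) (hball : a ≤ b * x) :
    a ≤ lam * x + 4 * K * b ^ 2 * x ^ 2 := by
  have hbx : 0 ≤ b * x := mul_nonneg hb hx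
  have hsq : (b * x + a) ^ 2 ≤ (2 * (b * x)) ^ 2 := by
    apply pow_le_pow_left₀ (by linarith) (by linarith)
  have : K * (b * x + a) ^ 2 ≤ K * (2 * (b * x)) ^ 2 := mul_le_mul_of_nonneg_left hsq hK
  nlinarith

/-- **(1.18) with a linear term** (NOT PRINTED; second engine for GAPS C-adv7-151's consequence census).  The three
pieces of (1.17) with `|H₀B′| ≤ b|B′|`, `|A₀| ≤ λ|B′| + 4C₄b³|B′|²` (instead of the printed quadratic (1.16)),
`|HD(x)| ≤ b·4C₂|x|²` for `|x| ≤ |H₀B′| + |A₀|`, under R2 `4C₂bε₂ ≤ 1`, R3 `4C₄b²ε₃ ≤ 1`, the strengthened R4′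
`3bε₃ ≤ ε₂`, `|B′| < ε₃` and `λ ≤ b`, add up to `|H_k B′| ≤ 6b|B′|` (printed constant: 4 = 1 + 1 + 2, pv20's
`B13Sect1Arith.bound_118`, cell GAPS C-adv7-156 (d); here 1 + 2 + 3).  Abstract nonnegative reals only. [folklore] -/
theorem bound_118_linear {C₂ C₄ b lam ε₂ ε₃ nB n1 n2 n3 nx : ℝ} (hC₂ : 0 ≤ C₂) (hC₄ : 0 ≤ C₄) (hb : 0 ≤ b)
    (hnB0 : 0 ≤ nB) (hnB : nB < ε₃) (hlam : lam ≤ b)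
    (hR2 : 4 * C₂ * b * ε₂ ≤ 1) (hR3 : 4 * C₄ * b ^ 2 * ε₃ ≤ 1) (hR4' : 3 * b * ε₃ ≤ ε₂)
    (h1 : n1 ≤ b * nB) (h2 : n2 ≤ lam * nB + 4 * C₄ * b ^ 3 * nB ^ 2) (hx0 : 0 ≤ nx)
    (hx : nx ≤ n1 + n2) (h3 : n3 ≤ b * (4 * C₂ * nx ^ 2)) :
    n1 + n2 + n3 ≤ 6 * b * nB := by
  have hbn : 0 ≤ b * nB := mul_nonneg hb hnB0
  have hε : 0 ≤ ε₃ := hnB0.trans hnB.le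
  -- the quadratic part of n2 is ≤ b nB (R3), the linear part ≤ b nB (λ ≤ b)
  have h2q : 4 * C₄ * b ^ 3 * nB ^ 2 ≤ b * nB := by
    have e : 4 * C₄ * b ^ 3 * nB ^ 2 = (b * nB) * (4 * C₄ * b ^ 2 * nB) := by ring
    have h' : 4 * C₄ * b ^ 2 * nB ≤ 1 :=
      (mul_le_mul_of_nonneg_left hnB.le (by positivity)).trans hR3
    rw [e]
    exact (mul_le_mul_of_nonneg_left h' hbn).trans (by simp)
  have h2l : lam * nB ≤ b * nB := mul_le_mul_of_nonneg_right hlam hnB0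
  have h2' : n2 ≤ 2 * (b * nB) := by linarith
  -- |x| ≤ 3 b |B′| and |x| ≤ 3 b ε₃ ≤ ε₂
  have hx1 : nx ≤ 3 * (b * nB) := by linarith
  have hx2 : nx ≤ ε₂ := by
    have : b * nB ≤ b * ε₃ := mul_le_mul_of_nonneg_left hnB.le hb
    linarith
  -- b · 4C₂|x|² ≤ b · 4C₂ · (3b|B′|) ε₂ = 3 b|B′| · (4C₂ b ε₂) ≤ 3 b |B′|
  have h3' : n3 ≤ 3 * (b * nB) := by
    have hsq : nx ^ 2 ≤ (3 * (b * nB)) * ε₂ := by nlinarith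
    have h4 : b * (4 * C₂ * nx ^ 2) ≤ b * (4 * C₂ * ((3 * (b * nB)) * ε₂)) :=
      mul_le_mul_of_nonneg_left (mul_le_mul_of_nonneg_left hsq (by positivity)) hb
    have e : b * (4 * C₂ * ((3 * (b * nB)) * ε₂)) = 3 * (b * nB) * (4 * C₂ * b * ε₂) := by ring
    have h5 : 3 * (b * nB) * (4 * C₂ * b * ε₂) ≤ 3 * (b * nB) := by
      have : 0 ≤ 3 * (b * nB) := by positivity
      exact (mul_le_mul_of_nonneg_left hR2 this).trans (by simp)
    linarith
  linarith

end Literature.MathematicalPhysics.QuantumFieldTheory.Balaban1983to89.B13Bound143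

end
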